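import Literature.Analysis.FluidPDE.PassiveScalarForcedTransportEnergy

/-!
# Conservative energy balance of the sourced transport equation (regular condensate, RC-Z)

Stub `stub_rcTransportEnergyEq` of the regular-condensate theorem (crux `TwohalfdNeg`, line
`log-kantorovich-enstrophy-transfer`): for a weak solution `Θ ∈ L^∞(0,T; L²(T²))` of the sourced
TRANSPORT equation `∂ₜΘ + W·∇Θ = h` on `T² × [0,T)` — the class
`Torus.IsWeakScalarTransportForcedOn T 0 W (fun _ => h) Θ₀ Θ` with `κ = 0`, so that `div W(t) = 0`
weakly for a.e. `t` — whose drift `W` is `L`-Lipschitz in space at every time, with `Θ₀ ∈ L²` and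
`h` smooth, the energy is conserved up to the work of the source:

  `‖Θ(t)‖²_{L²} = ‖Θ₀‖²_{L²} + 2 ∫_{(0,t]} ∫ Θ h`   for a.e. `t ∈ (0,T)`.

This is the `d = 2` instance of the general Literature theorem
`Literature.Analysis.FluidPDE.Torus.IsWeakScalarTransportForcedOn.integral_sq_eq_of_lipschitzWith`
(`Literature/Analysis/FluidPDE/PassiveScalarForcedTransportEnergy`; DiPerna–Lions 1989, §II.3,
Thm. II.3, in the Lipschitz setting): renormalised mollified identity with `κ = 0` and
`β_M = renorm M`, weak incompressibility killing the transport term, the Lipschitz commutator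
`rₙ → 0` in `L²` slice-wise and dominated in time, `n → ∞` at a.e. `t` and `M → ∞` by dominated
convergence; the limit lemmas are `PassiveScalarForcedRenormalizedLimits` and
`PassiveScalarForcedEnergyKinetic`. The registered hypotheses `0 < T` and the joint continuity of
`W` are not needed.

## References

* R. J. DiPerna, P.-L. Lions, *Ordinary differential equations, transport theory and Sobolev
  spaces*, Invent. Math. 98 (1989), 511–547, §II.3, Thm. II.3.
-/

namespace Summit.AnomalousDissipation.AnomalousDissipation.Theorems.TwohalfdNeg.RegularCondensate

open MeasureTheory Filter Topology
open scoped ENNReal NNReal InnerProductSpace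
open Literature.Analysis.FunctionSpaces Literature.Analysis.FluidPDE

set_option linter.dupNamespace false -- the registry path `AnomalousDissipation.AnomalousDissipation` (summit = problem)

/-- **RC-Z `stub_rcTransportEnergyEq` — conservative balance of the sourced TRANSPORT equation
(`κ = 0`) with a Lipschitz drift.** For a weak solution `Θ ∈ L^∞(0,T; L²)` of `∂ₜΘ + W·∇Θ = h` on
`T² × [0,T)` (`Torus.IsWeakScalarTransportForcedOn T 0 …`, so `div W(t) = 0` weakly for a.e. `t`)
with `W` jointly continuous and `L`-Lipschitz in space at every time, `Θ₀ ∈ L²` and `h` smooth: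
`‖Θ(t)‖² = ‖Θ₀‖² + 2∫_{(0,t]}∫ Θ h` for a.e. `t ∈ (0,T)`
(`Torus.IsWeakScalarTransportForcedOn.integral_sq_eq_of_lipschitzWith` in dimension `2`).
[cite: DiPernaLions1989, §II.3 Thm. II.3] -/
theorem stub_rcTransportEnergyEq :
    ∀ (T : ℝ) (L : ℝ≥0) (W : ℝ → UnitAddTorus (Fin 2) → EuclideanSpace ℝ (Fin 2))
      (h Θ₀ : UnitAddTorus (Fin 2) → ℝ) (Θ : ℝ → UnitAddTorus (Fin 2) → ℝ),
      0 < T → Torus.IsSmooth h → MemLp Θ₀ 2 volume →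
      Continuous (Function.uncurry W) → (∀ t, LipschitzWith L (W t)) →
      Torus.IsWeakScalarTransportForcedOn T 0 W (fun _ => h) Θ₀ Θ →
      ∀ᵐ t ∂(volume.restrict (Set.Ioo 0 T)),
        ∫ x, Θ t x ^ 2 = (∫ x, Θ₀ x ^ 2) + 2 * ∫ τ in Set.Ioc 0 t, ∫ x, Θ τ x * h x :=
  fun _ _ _ _ _ _ _ hh hΘ₀ _ hW hsol => hsol.integral_sq_eq_of_lipschitzWith hh hΘ₀ hW

end Summit.AnomalousDissipation.AnomalousDissipation.Theorems.TwohalfdNeg.RegularCondensate
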